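import Summits.Ventures.CertifiedQuantumChemistry.Rows.FeasiblePointLowerRows
import Literature.Computation.Certificates.ConicCertificateLayoutNegSplit
import Literature.Computation.Certificates.ConicCertificateLayoutIntervalBox
import HarnessLib

/-!
# Ventures/CertifiedQuantumChemistry — Rows/APosterioriLowerBoundConicLayout.lean: an ACCEPTED
# `certsdp-conic/1` document (kernel-replayable layout, `check = true`) of a programme that ENCODES a
# sector-necessary condition set IS a `LowerRow` (LADDER-CHEM I-TYPE slot 08, conic-layout form)

HONEST FRAMING (verbatim, page 1 of every file of the cell): certified bounds for a stated model
Hamiltonian in a stated basis; not a claim about the real molecule or material beyond that model.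

WHAT THIS FILE IS. The fourth sibling of slot 08's bridge family (`Rows/APosterioriLowerBound.lean`
equality / LMI form, `Rows/APosterioriLowerBoundConditions.lean` condition-set form,
`Rows/APosterioriLowerBoundNegSplit.lean` operator-bounded form — all stated over the ABSTRACT data of
`JanssonChaykinKeil.theorem_3_2_traceBound` / `lmiForm_bound(_negSplit)`: real matrices, every variable
boxed, every block trace-bounded). Here the certificate and the programme are the KERNEL-REPLAYABLE
LAYOUTS of the fleet's formats, typed by the certified-numerics cell with EXACT RATIONAL data, `Option`al
boxes / trace bounds / operator bounds and a `Bool`-valued acceptance check (the field-by-field image of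
what the readers of record verify):
* `ConicLayout.Problem` + `ConicLayout.LowerCert` (`certsdp-problem/1` + `certsdp-conic/1`, Gram and
  `dyadic-eig` block witnesses), soundness `ConicLayout.LowerCert.sound` :
  `check P C = true →` (`P.Feasible y → P.TraceBounds y → claimed ≤ P.obj y`)
  (`Literature/Computation/Certificates/ConicCertificateLayout.lean`);
* `ConicLayout.ProblemOp` + `ConicLayout.LowerCertNS` (+ the per-block a-priori OPERATOR bounds
  `lambda_max_bound` and the negative-part splits `neg_split`), soundness `ConicLayout.LowerCertNS.sound`
  (… `→ P.OpBounds y → claimed ≤ P.obj y`) (`…/ConicCertificateLayoutNegSplit.lean`);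
* `ConicLayout.Radii` + `ConicLayout.RealData` + `ConicLayout.LowerCertBox` (interval problem data:
  a REAL INSTANCE `D` of the document's entrywise box), soundness `ConicLayout.LowerCertBox.sound`
  (`check P R C = true → D.InBox P R → D.Feasible P y → D.TraceBounds P y → claimed_box ≤ D.obj y`)
  (`…/ConicCertificateLayoutIntervalBox.lean`).
Each of these stops at the SEMIDEFINITE objective. This file adds the one composition the venture's
rows need — with `Model.energy F a b = E₀(H_F; N_α = a, N_β = b)` — in the document's OWN semantics,
through the cell's uniform "one feasible point of energy at most `E₀`" layer
(`Rows/FeasiblePointLowerRows.lean`, `lowerRow_of_exists_feasible_le`; slot 07):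

§1 ENCODING PREDICATES at the RDM level (`Cnd` a condition set on pairs `(γ, Γ)`):
   `APosteriori.IsEncodingOfConic F Cnd P` — every `Cnd`-feasible pair has an image `y` that is
   `P`-feasible, satisfies the declared trace bounds, and has objective `≤ Re E_F(γ, Γ)` (the energy
   functional of the model); `APosteriori.IsEncodingOfConicOp` — the same plus the declared operator
   bounds `P.OpBounds y` (THIS is where the cell's a-priori constants are discharged per block: the trace
   constants of `PositivityBlockTraces` / `SpinBlockTraces`, the operator constants of
   `GarrodPercusEigenvalueBound`, `T1OperatorBound(DQG)`, `T2(Prime)OperatorBound`,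
   `Compacted*OperatorBounds`, `SubBlockT2(Prime)OperatorBounds`); `APosteriori.IsEncodingOfConicInstance`
   — the same for a real INSTANCE `D` of an interval document.  Nothing is asserted: which documents
   satisfy the predicates is established per generator (outside the kernel by the instance twins
   A ≡ B of record, or by a Lean proof for literal models).
§2 BRIDGES, plain layout: `lowerRow_of_conicLayout_check_of_exists` (ONE feasible point with trace
   bounds and objective `≤ E₀`, `check = true` ⇒ `LowerRow F a b claimed`), the primed variant without
   trace bounds when every eigenvalue floor is `≥ 0` (pure Gram mode, `LowerCert.sound'`),
   `IsEncodingOfConic.le_re_rdmEnergy_of_check` (the accepted bound lies below the energy functional on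
   the whole `Cnd`-feasible set), `IsEncodingOfConic.lowerRow_of_check` (symmetric `F`, `a, b ≤ k`,
   `Cnd` sector-necessary ⇒ `LowerRow`), and the `M = 0` flip-quotient corollary
   `IsEncodingOfConic.lowerRow_of_check_flip` (documents whose variables are the `θ`-symmetric moments).
§3 BRIDGES, operator-bounded / split layout (`LowerCertNS`): the same three.
§4 BRIDGES, interval layout (`LowerCertBox`): the same for an instance `D` in the box, and the remark
   that a document encodes its own midpoint instance (`IsEncodingOfConic.instance_realData`).
A printed outward-rounded `L ≤ claimed` is a row by `LowerRow.mono`.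

Printed anchors (pages opened by the typer). Jansson 2007 (held copy `paper:arxiv-0707.4366`):
Thm 4.1 (a) p. 8 "The primal optimal value is bounded from below by `⟨ỹ, b⟩ + ⟨d⁻, x̄⟩ =: f_p`";
Cor. 6.1 (a) p. 13 (SDP, `λ_max(X) ≤ x̄`: "`f_p ≥ bᵀỹ + l·d⁻·x̄`"); Cor. 7.1 (a) p. 14 (block form);
remark after (4.3), p. 9: "the input data `A, b, c` may be intervals, and we obtain a lower bound for
each instance within the interval data".  Cancès–Stoltz–Lewin 2006 §3 (held copy
`paper:arxiv-quant-ph_0602042` p. 5): "since `𝒞_app ⊃ 𝒞_N`, the energy `E_app` is a lower bound to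
the full CI energy in the chosen basis, `E_app ≤ E`" — used at ONE point, the sector ground state
(`exists_feasible_le_of_necessary`).  The generic bound itself is Jansson–Chaykin–Keil, SIAM J. Numer.
Anal. 46 (2007/08) 180–200, Lemma 3.1 / Thm 3.2 — in the tree as `JanssonChaykinKeil.lmiForm_bound`
and its layout corollaries above; NOTHING of it is restated here.

Everything is PROVED (0 sorry; 3 `def`s = the encoding predicates; no instance, no claim node, no model
literal, NO BOUND ASSERTED; standard axioms).  Typer seat chem-type-08 (cell chem-oracle); sibling
file, no accepted file edited.  NOT HERE (named so that nobody waits on it): the per-generator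
DISCHARGE of the encoding predicates for a concrete instance generator (one Lean proof or claim node per
certificate layout of a generator); the composite "interval box + split" layout (reserved by the
certified-numerics cell); float producers; losslessness of the bound.
-/

namespace Summit.Ventures.CertifiedQuantumChemistry

open Matrix Finset
open Literature.MathematicalPhysics.QuantumLattice Literature.MathematicalPhysics.QuantumChemistry
open Literature.Computation.Certificates

namespace APosteriori

variable {k : ℕ}
variable {V E I K : Type*} [Fintype V] [DecidableEq V] [Fintype E] [Fintype I] [Fintype K]
variable {σ : K → Type*} [∀ q, Fintype (σ q)] [∀ q, DecidableEq (σ q)]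
variable {π : K → Type*} [∀ q, Fintype (π q)]
variable {ω : K → Type*} [∀ q, Fintype (ω q)]

/-! ## §1 Encoding predicates in the document's own semantics -/

/-- **ENCODING PREDICATE, `certsdp-problem/1` layout.** The problem document `P` (exact rational data,
real semantics `ConicLayout.Problem.Feasible` / `TraceBounds` / `obj`) ENCODES the condition set `Cnd`
on RDM pairs for the model `F`: every `Cnd`-feasible pair `(γ, Γ)` has an image `y` that is feasible
for `P`, satisfies the declared a-priori trace bounds, and whose objective is at most the energy
functional `Re E_F(γ, Γ)`.  With `Cnd` sector-necessary this is the approximate cone `𝒞_app ⊃ 𝒞_N` of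
the variational RDM method written for the document: "since `𝒞_app ⊃ 𝒞_N`, the energy `E_app` is a
lower bound to the full CI energy in the chosen basis" — and the trace bounds are the a-priori bounds
the rigorous bound charges penalised blocks against.  Nothing is asserted.
[cite: CancesStoltzLewin2006, §3 eqs. (9)-(10), p.5] [cite: JanssonChaykinKeil2008, Thm 3.2
(inequality form: feasible set and a-priori bounds)] -/
def IsEncodingOfConic (F : Model k) (Cnd : PairCondition k) (P : ConicLayout.Problem V E I K σ) :
    Prop :=
  ∀ γ Γ, Cnd γ Γ → ∃ y : V → ℝ, P.Feasible y ∧ P.TraceBounds y ∧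
    P.obj y ≤
      (rdmEnergy (fun p q => (F.h p q : ℂ)) (fun p q r s => (F.eri p q r s : ℂ)) (F.ecore : ℂ)
        γ Γ).re

/-- **ENCODING PREDICATE, operator-bounded layout** (`certsdp-problem/1` with `lambda_max_bound`):
as `IsEncodingOfConic`, and the image `y` also satisfies the declared a-priori OPERATOR bounds
`x̄_q · 1 − M_q(y) ⪰ 0` (`ConicLayout.ProblemOp.OpBounds`) — the hypothesis "`X(ε) ≤ x̄ · I`" of the
eigenvalue form of the bound, to be discharged per block from the cell's operator constants on the
relaxed feasible set (`Γ ≤ N·1`, `G ≤ N·1`, `Q ≤ (r−N)·1`, `T1 ≤ (9N+6)·1`, …).  Nothing is asserted.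
[cite: Jansson2007, §6 Cor. 6.1 (ii) and (a), p.13] [cite: CancesStoltzLewin2006, §3 eqs. (9)-(10), p.5] -/
def IsEncodingOfConicOp (F : Model k) (Cnd : PairCondition k)
    (P : ConicLayout.ProblemOp V E I K σ) : Prop :=
  ∀ γ Γ, Cnd γ Γ → ∃ y : V → ℝ, P.toProblem.Feasible y ∧ P.toProblem.TraceBounds y ∧ P.OpBounds y ∧
    P.toProblem.obj y ≤
      (rdmEnergy (fun p q => (F.h p q : ℂ)) (fun p q r s => (F.eri p q r s : ℂ)) (F.ecore : ℂ)
        γ Γ).re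

/-- **ENCODING PREDICATE, interval layout (instance level).** A REAL INSTANCE `D` of the data of a
problem document `P` (`ConicLayout.RealData`: the true objective, rows and block data — e.g. the
model's exact programme of which the document's rationals are roundings; the unit variable, the
a-priori bounds and the trace bounds are the document's) encodes `Cnd` for `F`: every `Cnd`-feasible
pair has an image `y` feasible FOR THE INSTANCE with the document's trace bounds and instance
objective `≤ Re E_F(γ, Γ)` — "we obtain a lower bound for each instance within the interval data".
Nothing is asserted. [cite: Jansson2007, §4 remark after (4.3), p.9] [cite: JanssonChaykinKeil2008,
Thm 3.2 (interval input data)] [cite: CancesStoltzLewin2006, §3 eqs. (9)-(10), p.5] -/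
def IsEncodingOfConicInstance (F : Model k) (Cnd : PairCondition k)
    (P : ConicLayout.Problem V E I K σ) (D : ConicLayout.RealData V E I K σ) : Prop :=
  ∀ γ Γ, Cnd γ Γ → ∃ y : V → ℝ, D.Feasible P y ∧ D.TraceBounds P y ∧
    D.obj y ≤
      (rdmEnergy (fun p q => (F.h p q : ℂ)) (fun p q r s => (F.eri p q r s : ℂ)) (F.ecore : ℂ)
        γ Γ).re

omit [DecidableEq V] [Fintype E] [Fintype I] [Fintype K] [∀ q, DecidableEq (σ q)] in
/-- Encoding a condition set encodes every STRONGER condition set (adding conditions / rows to `Cnd`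
only shrinks the set of pairs to be embedded). [cite: CancesStoltzLewin2006, §3 eq. (7)] -/
theorem IsEncodingOfConic.anti {Cnd Cnd' : PairCondition k} {F : Model k}
    {P : ConicLayout.Problem V E I K σ} (hP : IsEncodingOfConic F Cnd P)
    (h : ∀ γ Γ, Cnd' γ Γ → Cnd γ Γ) : IsEncodingOfConic F Cnd' P :=
  fun γ Γ hγ => hP γ Γ (h γ Γ hγ)

omit [DecidableEq V] [Fintype E] [Fintype I] [Fintype K] in
/-- Forgetting the operator bounds: an operator-bounded encoding is an encoding of the underlying
`certsdp-problem/1` document. [cite: Jansson2007, §6 Cor. 6.1 (a), p.13] -/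
theorem IsEncodingOfConicOp.isEncodingOfConic {Cnd : PairCondition k} {F : Model k}
    {P : ConicLayout.ProblemOp V E I K σ} (hP : IsEncodingOfConicOp F Cnd P) :
    IsEncodingOfConic F Cnd P.toProblem :=
  fun γ Γ hγ => by
    obtain ⟨y, hy, htr, -, hE⟩ := hP γ Γ hγ
    exact ⟨y, hy, htr, hE⟩

omit [DecidableEq V] [Fintype E] [Fintype I] [Fintype K] in
/-- Encoding a condition set in the operator-bounded layout encodes every stronger condition set.
[cite: CancesStoltzLewin2006, §3 eq. (7)] -/
theorem IsEncodingOfConicOp.anti {Cnd Cnd' : PairCondition k} {F : Model k}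
    {P : ConicLayout.ProblemOp V E I K σ} (hP : IsEncodingOfConicOp F Cnd P)
    (h : ∀ γ Γ, Cnd' γ Γ → Cnd γ Γ) : IsEncodingOfConicOp F Cnd' P :=
  fun γ Γ hγ => hP γ Γ (h γ Γ hγ)

/-! ## §2 Plain layout: `certsdp-conic/1` (Gram / `dyadic-eig`) -/

/-- **ONE FEASIBLE POINT SUFFICES (conic layout).** For `a, b ≤ k`: an ACCEPTED `certsdp-conic/1`
certificate `C` of the document `P` (`ConicLayout.LowerCert.check P C = true` — kernel-evaluable by
`decide`, the field-by-field image of the readers' checks K-1…K-5) together with ONE point `y` that is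
`P`-feasible, satisfies the declared trace bounds and has objective `≤ E₀(H_F; a, b)` proves
`LowerRow F a b claimed`: `claimed ≤ c·y + c₀ ≤ E₀` (`ConicLayout.LowerCert.sound`).  The point is
supplied by the sector ground state of a necessary condition set (`IsEncodingOfConic.lowerRow_of_check`)
or by a `θ`-eigen ground state of a flip quotient (`…_flip`).
[cite: Jansson2007, §4 Thm 4.1 (a), p.8; §7 Cor. 7.1 (a), p.14] [cite: JanssonChaykinKeil2008,
Lemma 3.1 / Thm 3.2 (inequality-form corollary, tree decl `ConicLayout.LowerCert.sound`)]
[cite: CancesStoltzLewin2006, §3 eqs. (9)-(10), p.5] -/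
theorem lowerRow_of_conicLayout_check_of_exists {F : Model k} {a b : ℕ} (ha : a ≤ k) (hb : b ≤ k)
    {P : ConicLayout.Problem V E I K σ} {C : ConicLayout.LowerCert V E I K σ π}
    (h : ConicLayout.LowerCert.check P C = true)
    (hex : ∃ y : V → ℝ, P.Feasible y ∧ P.TraceBounds y ∧ P.obj y ≤ F.energy a b) :
    LowerRow F a b C.lowerBound := by
  obtain ⟨y, hy, htr, hE⟩ := hex
  exact ⟨ha, hb, (ConicLayout.LowerCert.sound h hy htr).trans hE⟩

/-- **One feasible point, no trace bounds needed** when every eigenvalue floor of the certificate is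
`≥ 0` (in particular in pure Gram mode — the exactly dual-feasible certificates the cell's solvers emit
beside their `cert/0` identities): `ConicLayout.LowerCert.sound'`.
[cite: JanssonChaykinKeil2008, Thm 3.2 (inequality-form corollary, case without penalised blocks)]
[cite: Jansson2007, §4 Thm 4.1 (b), p.8] -/
theorem lowerRow_of_conicLayout_check_of_exists' {F : Model k} {a b : ℕ} (ha : a ≤ k) (hb : b ≤ k)
    {P : ConicLayout.Problem V E I K σ} {C : ConicLayout.LowerCert V E I K σ π}
    (h : ConicLayout.LowerCert.check P C = true) (h0 : ∀ q, 0 ≤ (C.wit q).dfloor)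
    (hex : ∃ y : V → ℝ, P.Feasible y ∧ P.obj y ≤ F.energy a b) :
    LowerRow F a b C.lowerBound := by
  obtain ⟨y, hy, hE⟩ := hex
  exact ⟨ha, hb, (ConicLayout.LowerCert.sound' h h0 hy).trans hE⟩

/-- **The accepted bound lies below the energy functional on the whole encoded set**: under
`IsEncodingOfConic F Cnd P`, `check P C = true` gives `claimed ≤ Re E_F(γ, Γ)` for EVERY `Cnd`-feasible
pair — the hypothesis shape `hlo` of the cell's RDM-level soundness theorems
(`lowerRow_of_forall_necessary`, `lowerRow_of_exists_feasible_le`), so that the conic certificate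
composes with every reduction producing one feasible point of energy `≤ E₀`.
[cite: JanssonChaykinKeil2008, Thm 3.2 (inequality-form corollary)] [cite: Jansson2007, §7
Cor. 7.1 (a), p.14] -/
theorem IsEncodingOfConic.le_re_rdmEnergy_of_check {Cnd : PairCondition k} {F : Model k}
    {P : ConicLayout.Problem V E I K σ} (hP : IsEncodingOfConic F Cnd P)
    {C : ConicLayout.LowerCert V E I K σ π} (h : ConicLayout.LowerCert.check P C = true) :
    ∀ γ Γ, Cnd γ Γ → ((C.lowerBound : ℚ) : ℝ) ≤
      (rdmEnergy (fun p q => (F.h p q : ℂ)) (fun p q r s => (F.eri p q r s : ℂ)) (F.ecore : ℂ)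
        γ Γ).re :=
  fun γ Γ hγ => by
    obtain ⟨y, hy, htr, hE⟩ := hP γ Γ hγ
    exact (ConicLayout.LowerCert.sound h hy htr).trans hE

/-- **THE BRIDGE (conic layout, condition-set form).** For a symmetric model `F`, a physical sector
`a, b ≤ k`, a SECTOR-NECESSARY condition set `Cnd` (`IsNecessaryInSector a b Cnd`: e.g.
`IsDQGFeasibleSector a b`, the restricted / full three-index rungs, conjunctions with spin or `⟨Ŝ²⟩`
rows), a document `P` encoding `Cnd` for `F` and an ACCEPTED `certsdp-conic/1` certificate `C` of `P`:
`LowerRow F a b claimed`.  Proof: the RDM pair of the sector ground state is `Cnd`-feasible with energy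
functional `= E₀` (`exists_feasible_le_of_necessary`), and the accepted bound lies below the functional
there (`le_re_rdmEnergy_of_check`).  NOT COVERED: how a generator establishes `IsEncodingOfConic` for
its documents; the float producer; the certification of the floors (inside `check`).
[cite: Jansson2007, §7 Cor. 7.1 (a), p.14] [cite: JanssonChaykinKeil2008, Lemma 3.1 / Thm 3.2
(inequality-form corollary)] [cite: CancesStoltzLewin2006, §3 eqs. (7), (9)-(10), p.5] -/
theorem IsEncodingOfConic.lowerRow_of_check {F : Model k} (hF : F.IsSymmetric) {a b : ℕ}
    (ha : a ≤ k) (hb : b ≤ k) {Cnd : PairCondition k} (hCnd : IsNecessaryInSector a b Cnd)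
    {P : ConicLayout.Problem V E I K σ} (hP : IsEncodingOfConic F Cnd P)
    {C : ConicLayout.LowerCert V E I K σ π} (h : ConicLayout.LowerCert.check P C = true) :
    LowerRow F a b C.lowerBound :=
  lowerRow_of_exists_feasible_le ha hb (exists_feasible_le_of_necessary hF ha hb hCnd)
    (hP.le_re_rdmEnergy_of_check h)

/-- **THE BRIDGE for `M = 0` FLIP-QUOTIENT documents (conic layout).** For a symmetric model, a
balanced sector `(n, n)` with `n ≤ k`, a sector-necessary `Cnd` and a document `P` encoding the
condition set "`Cnd` and `θ`-symmetric" (`θ = Orb.spinSwap`; the variables of a flip-quotient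
generator are the `θ`-symmetric moments only) — or any weaker set `Cnd'` —, an accepted certificate of
`P` proves `LowerRow F n n claimed`: the feasible point is the pair of a `θ`-EIGEN ground state
(`exists_feasible_le_flip_of_necessary`). [cite: Mazziotti2007RDMChapter, §II.F p.48]
[cite: JanssonChaykinKeil2008, Thm 3.2 (inequality-form corollary)] [cite: GatermannParrilo2004, §3
Thm. 3.3 (proof)] -/
theorem IsEncodingOfConic.lowerRow_of_check_flip {F : Model k} (hF : F.IsSymmetric) {n : ℕ}
    (hn : n ≤ k) {Cnd Cnd' : PairCondition k} (hCnd : IsNecessaryInSector n n Cnd)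
    (hCnd' : ∀ γ Γ, Cnd γ Γ →
      (∀ i k', γ (Orb.spinSwap i) (Orb.spinSwap k') = γ i k') →
      (∀ i j k' l,
        Γ (Orb.spinSwap i, Orb.spinSwap j) (Orb.spinSwap k', Orb.spinSwap l) = Γ (i, j) (k', l)) →
      Cnd' γ Γ)
    {P : ConicLayout.Problem V E I K σ} (hP : IsEncodingOfConic F Cnd' P)
    {C : ConicLayout.LowerCert V E I K σ π} (h : ConicLayout.LowerCert.check P C = true) :
    LowerRow F n n C.lowerBound :=
  lowerRow_of_exists_feasible_le hn hn (exists_feasible_le_flip_of_necessary hF hn hCnd hCnd')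
    (hP.le_re_rdmEnergy_of_check h)

/-! ## §3 Operator-bounded / split layout: `certsdp-conic/1` with `neg_split` -/

/-- **ONE FEASIBLE POINT SUFFICES (split layout).** For `a, b ≤ k`: an ACCEPTED certificate with
negative-part splits `C` of the operator-bounded document `P` (`ConicLayout.LowerCertNS.check P C = true`)
and ONE point `y` that is feasible, satisfies the declared trace AND operator bounds and has objective
`≤ E₀(H_F; a, b)` prove `LowerRow F a b claimed` (`ConicLayout.LowerCertNS.sound`: the bound formula
carries the penalties `Σ_q |min(0,d_q)| τ_q + Σ_q x̄_q ‖W_q‖_F²`).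
[cite: Jansson2007, §4 Lemma 4.1 / Thm 4.1 (a), p.8; §6 Cor. 6.1 (a), p.13]
[cite: JanssonChaykinKeil2008, Lemma 3.1 / Thm 3.2 (tree decl `ConicLayout.LowerCertNS.sound`)] -/
theorem lowerRow_of_conicLayoutNS_check_of_exists {F : Model k} {a b : ℕ} (ha : a ≤ k) (hb : b ≤ k)
    {P : ConicLayout.ProblemOp V E I K σ} {C : ConicLayout.LowerCertNS V E I K σ π ω}
    (h : ConicLayout.LowerCertNS.check P C = true)
    (hex : ∃ y : V → ℝ, P.toProblem.Feasible y ∧ P.toProblem.TraceBounds y ∧ P.OpBounds y ∧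
      P.toProblem.obj y ≤ F.energy a b) :
    LowerRow F a b C.lowerBound := by
  obtain ⟨y, hy, htr, hop, hE⟩ := hex
  exact ⟨ha, hb, (ConicLayout.LowerCertNS.sound h hy htr hop).trans hE⟩

/-- **One feasible point, no trace bounds needed (split layout)** when every eigenvalue floor of the
certified parts `P_q` is `≥ 0` (the producer's Gram / Cholesky path): `ConicLayout.LowerCertNS.sound'`;
the operator bounds are still required (they price the splits).
[cite: Jansson2007, §6 Cor. 6.1 (a), p.13] [cite: JanssonChaykinKeil2008, Thm 3.2 (inequality-form
corollary, case without penalised blocks)] -/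
theorem lowerRow_of_conicLayoutNS_check_of_exists' {F : Model k} {a b : ℕ} (ha : a ≤ k) (hb : b ≤ k)
    {P : ConicLayout.ProblemOp V E I K σ} {C : ConicLayout.LowerCertNS V E I K σ π ω}
    (h : ConicLayout.LowerCertNS.check P C = true) (h0 : ∀ q, 0 ≤ (C.wit q).dfloor)
    (hex : ∃ y : V → ℝ, P.toProblem.Feasible y ∧ P.OpBounds y ∧ P.toProblem.obj y ≤ F.energy a b) :
    LowerRow F a b C.lowerBound := by
  obtain ⟨y, hy, hop, hE⟩ := hex
  exact ⟨ha, hb, (ConicLayout.LowerCertNS.sound' h h0 hy hop).trans hE⟩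

/-- Under `IsEncodingOfConicOp F Cnd P`, an accepted split certificate lies below the energy functional
on the whole `Cnd`-feasible set (hypothesis shape `hlo` of the RDM-level soundness theorems).
[cite: Jansson2007, §6 Cor. 6.1 (a), p.13] [cite: JanssonChaykinKeil2008, Thm 3.2 (inequality-form
corollary)] -/
theorem IsEncodingOfConicOp.le_re_rdmEnergy_of_check {Cnd : PairCondition k} {F : Model k}
    {P : ConicLayout.ProblemOp V E I K σ} (hP : IsEncodingOfConicOp F Cnd P)
    {C : ConicLayout.LowerCertNS V E I K σ π ω} (h : ConicLayout.LowerCertNS.check P C = true) :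
    ∀ γ Γ, Cnd γ Γ → ((C.lowerBound : ℚ) : ℝ) ≤
      (rdmEnergy (fun p q => (F.h p q : ℂ)) (fun p q r s => (F.eri p q r s : ℂ)) (F.ecore : ℂ)
        γ Γ).re :=
  fun γ Γ hγ => by
    obtain ⟨y, hy, htr, hop, hE⟩ := hP γ Γ hγ
    exact (ConicLayout.LowerCertNS.sound h hy htr hop).trans hE

/-- **THE BRIDGE (split layout, condition-set form).** Symmetric `F`, `a, b ≤ k`, `Cnd` sector-necessary,
`P` an operator-bounded document encoding `Cnd` for `F` (trace AND operator bounds discharged on the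
`Cnd`-feasible set), `C` an ACCEPTED certificate with splits: `LowerRow F a b claimed`.
[cite: Jansson2007, §6 Cor. 6.1 (a), p.13; §7 Cor. 7.1 (a), p.14] [cite: JanssonChaykinKeil2008,
Lemma 3.1 / Thm 3.2 (inequality-form corollary)] [cite: CancesStoltzLewin2006, §3 eqs. (7), (9)-(10), p.5] -/
theorem IsEncodingOfConicOp.lowerRow_of_check {F : Model k} (hF : F.IsSymmetric) {a b : ℕ}
    (ha : a ≤ k) (hb : b ≤ k) {Cnd : PairCondition k} (hCnd : IsNecessaryInSector a b Cnd)
    {P : ConicLayout.ProblemOp V E I K σ} (hP : IsEncodingOfConicOp F Cnd P)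
    {C : ConicLayout.LowerCertNS V E I K σ π ω} (h : ConicLayout.LowerCertNS.check P C = true) :
    LowerRow F a b C.lowerBound :=
  lowerRow_of_exists_feasible_le ha hb (exists_feasible_le_of_necessary hF ha hb hCnd)
    (hP.le_re_rdmEnergy_of_check h)

/-- **THE BRIDGE for `M = 0` FLIP-QUOTIENT documents (split layout)** — as
`IsEncodingOfConic.lowerRow_of_check_flip`, for an operator-bounded document encoding "`Cnd` and
`θ`-symmetric" (or a weaker `Cnd'`). [cite: Mazziotti2007RDMChapter, §II.F p.48]
[cite: Jansson2007, §6 Cor. 6.1 (a), p.13] [cite: GatermannParrilo2004, §3 Thm. 3.3 (proof)] -/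
theorem IsEncodingOfConicOp.lowerRow_of_check_flip {F : Model k} (hF : F.IsSymmetric) {n : ℕ}
    (hn : n ≤ k) {Cnd Cnd' : PairCondition k} (hCnd : IsNecessaryInSector n n Cnd)
    (hCnd' : ∀ γ Γ, Cnd γ Γ →
      (∀ i k', γ (Orb.spinSwap i) (Orb.spinSwap k') = γ i k') →
      (∀ i j k' l,
        Γ (Orb.spinSwap i, Orb.spinSwap j) (Orb.spinSwap k', Orb.spinSwap l) = Γ (i, j) (k', l)) →
      Cnd' γ Γ)
    {P : ConicLayout.ProblemOp V E I K σ} (hP : IsEncodingOfConicOp F Cnd' P)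
    {C : ConicLayout.LowerCertNS V E I K σ π ω} (h : ConicLayout.LowerCertNS.check P C = true) :
    LowerRow F n n C.lowerBound :=
  lowerRow_of_exists_feasible_le hn hn (exists_feasible_le_flip_of_necessary hF hn hCnd hCnd')
    (hP.le_re_rdmEnergy_of_check h)

/-! ## §4 Interval layout: `certsdp-conic/1` with a box claim against `certsdp-problem/1` + `interval` -/

/-- **ONE FEASIBLE POINT OF THE INSTANCE SUFFICES (interval layout).** For `a, b ≤ k`: an ACCEPTED
box-claiming certificate `C` of the document `P` with radii `R` (`ConicLayout.LowerCertBox.check P R C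
= true`), a real INSTANCE `D` in the box (`D.InBox P R`) and ONE point `y` feasible for the instance with
the document's trace bounds and instance objective `≤ E₀(H_F; a, b)` prove `LowerRow F a b claimed_box`
(`ConicLayout.LowerCertBox.sound`: "a lower bound for each instance within the interval data").
[cite: Jansson2007, §4 Thm 4.2 and remark after (4.3), p.9] [cite: JanssonChaykinKeil2008, Lemma 3.1 /
Thm 3.2 (interval input data; tree decl `ConicLayout.LowerCertBox.sound`)] -/
theorem lowerRow_of_conicLayoutBox_check_of_exists {F : Model k} {a b : ℕ} (ha : a ≤ k) (hb : b ≤ k)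
    {P : ConicLayout.Problem V E I K σ} {R : ConicLayout.Radii V E I K σ}
    {C : ConicLayout.LowerCertBox V E I K σ π} (h : ConicLayout.LowerCertBox.check P R C = true)
    {D : ConicLayout.RealData V E I K σ} (hD : D.InBox P R)
    (hex : ∃ y : V → ℝ, D.Feasible P y ∧ D.TraceBounds P y ∧ D.obj y ≤ F.energy a b) :
    LowerRow F a b C.lowerBoundBox := by
  obtain ⟨y, hy, htr, hE⟩ := hex
  exact ⟨ha, hb, (ConicLayout.LowerCertBox.sound h hD hy htr).trans hE⟩

/-- Under `IsEncodingOfConicInstance F Cnd P D` with `D` in the box of `(P, R)`, an accepted box-claiming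
certificate's `claimed_box` lies below the energy functional on the whole `Cnd`-feasible set.
[cite: Jansson2007, §4 Thm 4.2 and remark after (4.3), p.9] [cite: JanssonChaykinKeil2008, Thm 3.2
(interval input data)] -/
theorem IsEncodingOfConicInstance.le_re_rdmEnergy_of_check {Cnd : PairCondition k} {F : Model k}
    {P : ConicLayout.Problem V E I K σ} {D : ConicLayout.RealData V E I K σ}
    (hP : IsEncodingOfConicInstance F Cnd P D) {R : ConicLayout.Radii V E I K σ} (hD : D.InBox P R)
    {C : ConicLayout.LowerCertBox V E I K σ π} (h : ConicLayout.LowerCertBox.check P R C = true) :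
    ∀ γ Γ, Cnd γ Γ → ((C.lowerBoundBox : ℚ) : ℝ) ≤
      (rdmEnergy (fun p q => (F.h p q : ℂ)) (fun p q r s => (F.eri p q r s : ℂ)) (F.ecore : ℂ)
        γ Γ).re :=
  fun γ Γ hγ => by
    obtain ⟨y, hy, htr, hE⟩ := hP γ Γ hγ
    exact (ConicLayout.LowerCertBox.sound h hD hy htr).trans hE

/-- **THE BRIDGE (interval layout, condition-set form).** Symmetric `F`, `a, b ≤ k`, `Cnd`
sector-necessary, a real instance `D` (e.g. the model's exact programme) encoding `Cnd` for `F` and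
lying in the entrywise box of the document `P` with radii `R`, and an ACCEPTED box-claiming certificate:
`LowerRow F a b claimed_box`. [cite: Jansson2007, §4 Thm 4.2 and remark after (4.3), p.9; §7 Cor. 7.1
(a), p.14] [cite: JanssonChaykinKeil2008, Lemma 3.1 / Thm 3.2 (interval input data)]
[cite: CancesStoltzLewin2006, §3 eqs. (7), (9)-(10), p.5] -/
theorem IsEncodingOfConicInstance.lowerRow_of_check {F : Model k} (hF : F.IsSymmetric) {a b : ℕ}
    (ha : a ≤ k) (hb : b ≤ k) {Cnd : PairCondition k} (hCnd : IsNecessaryInSector a b Cnd)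
    {P : ConicLayout.Problem V E I K σ} {D : ConicLayout.RealData V E I K σ}
    (hP : IsEncodingOfConicInstance F Cnd P D) {R : ConicLayout.Radii V E I K σ} (hD : D.InBox P R)
    {C : ConicLayout.LowerCertBox V E I K σ π} (h : ConicLayout.LowerCertBox.check P R C = true) :
    LowerRow F a b C.lowerBoundBox :=
  lowerRow_of_exists_feasible_le ha hb (exists_feasible_le_of_necessary hF ha hb hCnd)
    (hP.le_re_rdmEnergy_of_check hD h)

omit [DecidableEq V] [Fintype E] [Fintype I] [Fintype K] [∀ q, DecidableEq (σ q)] in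
/-- **A document encodes its own midpoint instance**: `IsEncodingOfConic F Cnd P` gives
`IsEncodingOfConicInstance F Cnd P P.realData` (`ConicLayout.Problem.feasible_realData_iff`; the blocks
and the objective of `P.realData` are those of `P`), so a second rational document within the radii is
handled by `ConicLayout.LowerCertBox.sound_problem` and an exact document by §2.
[cite: JanssonChaykinKeil2008, Thm 3.2 (a realisation of the interval data)] -/
theorem IsEncodingOfConic.instance_realData {Cnd : PairCondition k} {F : Model k}
    {P : ConicLayout.Problem V E I K σ} (hP : IsEncodingOfConic F Cnd P) :
    IsEncodingOfConicInstance F Cnd P P.realData :=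
  fun γ Γ hγ => by
    obtain ⟨y, hy, htr, hE⟩ := hP γ Γ hγ
    exact ⟨y, (ConicLayout.Problem.feasible_realData_iff rfl rfl).2 hy, htr, hE⟩

end APosteriori

end Summit.Ventures.CertifiedQuantumChemistry
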